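import Literature.Computability.Cryptography.RegevVerificationFourier
import Literature.Computability.Cryptography.IndepLawBridge
import Literature.Probability.Moments.HoeffdingPMF
import Literature.Probability.Distributions.BindExpectation
import Mathlib.Analysis.SpecialFunctions.Trigonometric.Bounds
import HarnessLib

/-!
# Regev 2009, Lemma 3.6 (verifying a candidate `LWE` secret): the test on finely discretised samples, with its error bounds

Topic `Computability/Cryptography` (family `pqc`), grouping namespace `Regev2009`; sequel of
`RegevVerificationFourier.lean` (the MEANS of Regev's statistic on the torus). Everything here is PROVED
(theorems, plus small definitions WITH BODIES naming the objects; no named fact).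

**Lemma 3.6** (Regev, J. ACM 56 (2009) = arXiv:2401.03703, §3.2.1): *there is an efficient algorithm
that, given `s'` and samples from `A_{s,Ψ_β}` for some unknown `s` and `β ≤ α < 1`, decides whether
`s' = s` with probability exponentially close to `1`.* Printed procedure: from each sample `(a, x)` form
`y = x - ⟨a, s'⟩/p`, compute `z = (1/n)∑ cos(2πy)`; accept iff `z` exceeds a threshold; `E[cos 2πy]` is
`e^{-πβ²} ≥ e^{-π}` if `s' = s` and `0` otherwise, and the Chernoff bound separates the two.

This file runs the test on samples whose second component is DISCRETISED, at a modulus `qK` FINER than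
the `LWE` modulus `q` — the format in which the classical reduction of Lemma 3.4 (= Peikert 2009,
Prop. 3.2, hypothesis `h₂` of `peikert_gapSVPZeta_to_lwe_classical_of_components`, pqc.S20) holds its own
manufactured samples `(a, ⌊qK·(⟨x,v⟩/q + e)⌉ mod qK)` (exact rationals rounded at scale `1/(qK)`), while
the oracle is fed the coarse roundings `⌊q·⌉ mod q`. The point of the finer scale: the rounding moves the
`s' = s` mean by at most `π/(qK)`, so ONE constant `K` (any `K` with `qK ≥ 4π e^{π}`, e.g. `K = 147`)
serves every modulus `q ≥ 2` and every `β ≤ α < 1`, with no assumption relating `q` to the noise.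

## Objects (definitions with bodies)

* `kmul q K : ℤ_q →+ ℤ_{qK}`, `x ↦ K·x` (the embedding of the coarse residues into the fine ones);
  `toCircle_kmul : e^{2πi·kmul(x)/(qK)} = e^{2πi x/q}`.
* `lweSampleK q K χ s` — the fine `LWE` distribution `A^{(K)}_{s,χ}` on `ℤ_qⁿ × ℤ_{qK}`: `a` uniform,
  `b = kmul⟨a, s⟩ + e`, `e ← χ` (`χ` a law on `ℤ_{qK}`; for the reduction, `χ = Ψ̄^{(qK)}_β =
  LWE.discretizedGaussian (q*K) β`).
* `testCos q K s' (a, b) = cos(2π(b - kmul⟨a, s'⟩)/(qK))` (Regev's `cos(2πy)`), `cosMean χ = E_χ[cos(2πe/(qK))]`,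
  `verifyStat` (the sum over a batch), `acceptSet θ s'` (accept iff the sum is `≥ Nθ`).

## Results

* `tsum_lweSampleK_testCos` — **the means**: `E_{A^{(K)}_{s,χ}}[testCos s'] = cosMean χ` if `s' = s`, and
  `= 0` if `s' ≠ s` (character factorisation `e^{2πi(b - kmul⟨a,s'⟩)/(qK)} = e^{2πi⟨a, s-s'⟩/q}·e^{2πie/(qK)}`
  and the cancellation `∑ₐ e^{2πi⟨a,d⟩/q} = 0`, `d ≠ 0`, of `RegevVerificationFourier.lean`).
* `exp_sub_le_cosMean_discretizedGaussian` — **`cosMean Ψ̄^{(Q)}_β ≥ e^{-πβ²} - π/Q`** (the torus mean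
  `e^{-πβ²}` of `RegevVerificationFourier.lean` and `|cos u - cos v| ≤ |u - v|`, `|Qx - ⌊Qx⌉| ≤ 1/2`).
* `toReal_accept_of_ne_le` — **wrong candidate**: `Pr[accept] ≤ exp(-Nθ²/8)` (`θ ≥ 0`);
  `toReal_reject_self_le` — **right candidate**: `Pr[reject] ≤ exp(-N(cosMean χ - θ)²/8)` (`θ ≤ cosMean χ`)
  (Hoeffding, `Probability/Moments/HoeffdingPMF.lean`, on the `N`-fold iid batch `LWE.iidPMF`).
* `toReal_accept_of_ne_le_exp`, `toReal_reject_self_le_exp` — the concrete instance used downstream: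
  `χ = Ψ̄^{(qK)}_β`, `|β| ≤ α`, threshold `θ = e^{-πα²}/2`, `4π e^{πα²} ≤ qK`:
  `Pr[accept s' ≠ s] ≤ exp(-N e^{-2πα²}/32)` and `Pr[reject s] ≤ exp(-N e^{-2πα²}/128)`.

## Faithfulness notes

* Regev runs the test on exact torus samples; a reduction holding exact rationals may round them at any
  scale it likes, and `qK` with a constant `K` is the cheapest scale at which the printed analysis goes
  through verbatim for all `q ≥ 2` (for the coarse scale `q` itself the `s' = s` mean
  `∑ⱼ Ψ̄_β(j)cos(2πj/q)` is still positive but its uniform lower bound needs the Jacobi-theta analysis of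
  `DiscretizedGaussianMass.lean`; not needed here).
* Thresholds/constants: Regev's `0.02`/`0.04` become `e^{-πα²}/2` and the explicit Hoeffding exponents;
  "`n` samples, error exponentially small" is `N` samples with the displayed bounds.

## References

* O. Regev, *On lattices, learning with errors, random linear codes, and cryptography*, J. ACM 56
  (2009), art. 34 = arXiv:2401.03703, Lemma 3.6 and its proof (§3.2.1) [RegevLWE2009].
* W. Hoeffding, *Probability inequalities for sums of bounded random variables*, JASA 58 (1963), Thm. 2
  [Hoeffding1963].
* C. Peikert, *Public-key cryptosystems from the worst-case shortest vector problem*, STOC 2009,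
  Prop. 3.2 (the consumer) [Peikert2009].
-/

noncomputable section

open MeasureTheory ProbabilityTheory Complex Finset
open scoped Real ENNReal NNReal

namespace Literature.Computability.Cryptography

namespace Regev2009

open Literature.Probability.Distributions Literature.Probability.Moments

/-! ### The embedding `ℤ_q → ℤ_{qK}`, `x ↦ Kx` -/

section KMul

variable (q K : ℕ)

/-- LOCAL GLUE. The additive embedding `kmul : ℤ_q →+ ℤ_{qK}`, `x ↦ K·x` (well defined since
`K·q ≡ 0 (mod qK)`): it carries the coarse quantities `⟨a, s⟩ ∈ ℤ_q` into the fine residue group in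
which the reduction's own samples are rounded. [folklore] -/
def kmul : ZMod q →+ ZMod (q * K) :=
  ZMod.lift q ⟨(Int.castAddHom (ZMod (q * K))).comp (AddMonoidHom.mulLeft (K : ℤ)), by
    change (((K : ℤ) * (q : ℤ) : ℤ) : ZMod (q * K)) = 0
    have h : (((K : ℤ) * (q : ℤ) : ℤ) : ZMod (q * K)) = ((q * K : ℕ) : ZMod (q * K)) := by
      push_cast; ring
    rw [h, ZMod.natCast_self]⟩

/-- `kmul (z mod q) = Kz mod qK`. [folklore] -/
theorem kmul_intCast (z : ℤ) : kmul q K (z : ZMod q) = (((K : ℤ) * z : ℤ) : ZMod (q * K)) := by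
  rw [kmul, ZMod.lift_coe]
  rfl

/-- **The fine character restricted along `kmul` is the coarse character**:
`e^{2πi·kmul(x)/(qK)} = e^{2πi x/q}` (`NeZero (q * K)` is Mathlib's instance from `NeZero q`,
`NeZero K`). [folklore] -/
theorem toCircle_kmul [NeZero q] [NeZero K] (x : ZMod q) :
    ((ZMod.toCircle (kmul q K x) : Circle) : ℂ) = ((ZMod.toCircle x : Circle) : ℂ) := by
  have hx : x = ((x.val : ℤ) : ZMod q) := by simp
  conv_lhs => rw [hx, kmul_intCast, ZMod.toCircle_intCast]
  conv_rhs => rw [hx, ZMod.toCircle_intCast]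
  congr 1
  have hK : (K : ℂ) ≠ 0 := Nat.cast_ne_zero.2 (NeZero.ne K)
  have hq : (q : ℂ) ≠ 0 := Nat.cast_ne_zero.2 (NeZero.ne q)
  push_cast
  field_simp

end KMul

/-! ### Fine `LWE` samples and Regev's statistic -/

section Sample

variable {ι : Type} [Fintype ι] [DecidableEq ι] (q K : ℕ) [NeZero q] [NeZero K]

/-- LOCAL GLUE. The fine `LWE` distribution `A^{(K)}_{s,χ}` on `ℤ_qⁿ × ℤ_{qK}`: `a` uniform in `ℤ_qⁿ`,
`b = kmul⟨a, s⟩ + e` with `e ← χ`, a law on `ℤ_{qK}` (the ideal law of the reduction's verification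
samples `(a, ⌊qK·y⌉ mod qK)`; compare `LWE.lweSample`, the case `K = 1`). [cite: RegevLWE2009, §2 (`A_{s,χ}`) with Lemma 3.6] -/
def lweSampleK (χ : PMF (ZMod (q * K))) (s : ι → ZMod q) : PMF ((ι → ZMod q) × ZMod (q * K)) :=
  (PMF.uniformOfFintype (ι → ZMod q)).bind fun a => χ.map fun e => (a, kmul q K (a ⬝ᵥ s) + e)

/-- Regev's statistic `cos(2πy)`, `y = (b - kmul⟨a, s'⟩)/(qK)`, on a fine sample `(a, b)` for the
candidate `s'` (the real part of the fine character at the residual). [cite: RegevLWE2009, Lemma 3.6 (proof: "`z := (1/n)∑cos(2πyᵢ)`")] -/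
def testCos (s' : ι → ZMod q) (x : (ι → ZMod q) × ZMod (q * K)) : ℝ :=
  ((ZMod.toCircle (x.2 - kmul q K (x.1 ⬝ᵥ s')) : Circle) : ℂ).re

/-- The `s' = s` mean of the statistic depends only on the noise: `cosMean χ = E_{e←χ}[cos(2πe/(qK))]`.
[cite: RegevLWE2009, Lemma 3.6 (proof: "`z̃ = e^{-πα²}`")] -/
def cosMean {Q : ℕ} [NeZero Q] (χ : PMF (ZMod Q)) : ℝ :=
  ∑ e, (χ e).toReal * ((ZMod.toCircle e : Circle) : ℂ).re

omit [DecidableEq ι] in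
/-- `|cos| ≤ 1`. [folklore] -/
theorem abs_testCos_le_one (s' : ι → ZMod q) (x : (ι → ZMod q) × ZMod (q * K)) :
    |testCos q K s' x| ≤ 1 := by
  unfold testCos
  exact (Complex.abs_re_le_norm _).trans_eq (Circle.norm_coe _)

omit [DecidableEq ι] in
/-- **Character factorisation** (Regev: `y = ⟨a, s - s'⟩/p + e`): on the sample `(a, kmul⟨a,s⟩ + e)` the
fine character at the residual against `s'` is `e^{2πi⟨a, s-s'⟩/q} · e^{2πie/(qK)}`. [cite: RegevLWE2009, Lemma 3.6 (proof)] -/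
theorem toCircle_residual (s s' a : ι → ZMod q) (e : ZMod (q * K)) :
    ((ZMod.toCircle (kmul q K (a ⬝ᵥ s) + e - kmul q K (a ⬝ᵥ s')) : Circle) : ℂ) =
      ((ZMod.toCircle (a ⬝ᵥ (s - s')) : Circle) : ℂ) * ((ZMod.toCircle e : Circle) : ℂ) := by
  rw [show kmul q K (a ⬝ᵥ s) + e - kmul q K (a ⬝ᵥ s') = kmul q K (a ⬝ᵥ (s - s')) + e by
    rw [dotProduct_sub, map_sub]; abel, AddChar.map_add_eq_mul, Circle.coe_mul, toCircle_kmul]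

omit [DecidableEq ι] in
/-- The statistic on the sample `(a, kmul⟨a,s⟩ + e)`, in real form:
`cos(A + B) = cos A cos B - sin A sin B` with `e^{iA} = e^{2πi⟨a,s-s'⟩/q}`, `e^{iB} = e^{2πie/(qK)}`. [folklore] -/
theorem testCos_sample (s s' a : ι → ZMod q) (e : ZMod (q * K)) :
    testCos q K s' (a, kmul q K (a ⬝ᵥ s) + e) =
      ((ZMod.toCircle (a ⬝ᵥ (s - s')) : Circle) : ℂ).re * ((ZMod.toCircle e : Circle) : ℂ).re -
        ((ZMod.toCircle (a ⬝ᵥ (s - s')) : Circle) : ℂ).im * ((ZMod.toCircle e : Circle) : ℂ).im := by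
  unfold testCos
  rw [toCircle_residual, Complex.mul_re]

/-- **Expectations under `A^{(K)}_{s,χ}`** (bounded test functions): average over the uniform `a`, then
over the noise. [folklore] -/
theorem tsum_lweSampleK_mul (χ : PMF (ZMod (q * K))) (s : ι → ZMod q)
    {f : (ι → ZMod q) × ZMod (q * K) → ℝ} {M : ℝ} (hf : ∀ x, |f x| ≤ M) :
    ∑' x, (lweSampleK q K χ s x).toReal * f x =
      ∑ a : ι → ZMod q, ((Fintype.card (ι → ZMod q) : ℝ))⁻¹ *
        ∑ e, (χ e).toReal * f (a, kmul q K (a ⬝ᵥ s) + e) := by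
  rw [lweSampleK, PMF.tsum_toReal_bind_mul _ _ hf, tsum_fintype]
  refine sum_congr rfl fun a _ => ?_
  rw [PMF.tsum_toReal_map_mul _ _ hf, tsum_fintype, PMF.uniformOfFintype_apply, ENNReal.toReal_inv,
    ENNReal.toReal_natCast]

/-- **Regev 2009, Lemma 3.6 — the two means, fine-discretised form.** Under `A^{(K)}_{s,χ}` the statistic
`cos(2π(b - kmul⟨a,s'⟩)/(qK))` has mean `cosMean χ` if `s' = s` ("`ξ` is exactly `Ψ_α`") and mean `0`
if `s' ≠ s` ("`ξ` has period `1/k`, `k ≥ 2` … `z̃ = 0`": the character sum over `a` vanishes).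
[cite: RegevLWE2009, Lemma 3.6 (proof)] -/
theorem tsum_lweSampleK_testCos (χ : PMF (ZMod (q * K))) (s s' : ι → ZMod q) :
    ∑' x, (lweSampleK q K χ s x).toReal * testCos q K s' x = if s' = s then cosMean χ else 0 := by
  rw [tsum_lweSampleK_mul q K χ s (abs_testCos_le_one q K s')]
  have hcard : ((Fintype.card (ι → ZMod q) : ℝ)) ≠ 0 := Nat.cast_ne_zero.2 Fintype.card_ne_zero
  by_cases h : s' = s
  · subst h
    rw [if_pos rfl]
    have h1 : ∀ (a : ι → ZMod q) (e : ZMod (q * K)),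
        testCos q K s' (a, kmul q K (a ⬝ᵥ s') + e) = ((ZMod.toCircle e : Circle) : ℂ).re := fun a e => by
      unfold testCos
      rw [add_sub_cancel_left]
    simp_rw [h1]
    rw [sum_const, card_univ, nsmul_eq_mul, ← mul_assoc, mul_inv_cancel₀ hcard, one_mul, cosMean]
  · rw [if_neg h]
    -- the real and imaginary parts of the vanishing character sum over `a`
    have hsum : ∑ a : ι → ZMod q, ((ZMod.toCircle (a ⬝ᵥ (s - s')) : Circle) : ℂ) = 0 :=
      sum_toCircle_dotProduct_eq_zero (sub_ne_zero.2 (Ne.symm h))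
    have hre : ∑ a : ι → ZMod q, ((ZMod.toCircle (a ⬝ᵥ (s - s')) : Circle) : ℂ).re = 0 := by
      rw [← Complex.re_sum, hsum, Complex.zero_re]
    have him : ∑ a : ι → ZMod q, ((ZMod.toCircle (a ⬝ᵥ (s - s')) : Circle) : ℂ).im = 0 := by
      rw [← Complex.im_sum, hsum, Complex.zero_im]
    set X : ℝ := ∑ e, (χ e).toReal * ((ZMod.toCircle e : Circle) : ℂ).re with hX
    set Y : ℝ := ∑ e, (χ e).toReal * ((ZMod.toCircle e : Circle) : ℂ).im with hY
    have hinner : ∀ a : ι → ZMod q, ∑ e, (χ e).toReal * testCos q K s' (a, kmul q K (a ⬝ᵥ s) + e) =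
        ((ZMod.toCircle (a ⬝ᵥ (s - s')) : Circle) : ℂ).re * X -
          ((ZMod.toCircle (a ⬝ᵥ (s - s')) : Circle) : ℂ).im * Y := fun a => by
      simp_rw [testCos_sample, hX, hY, mul_sum, ← sum_sub_distrib]
      exact sum_congr rfl fun e _ => by ring
    simp_rw [hinner, mul_sub, sum_sub_distrib]
    have h2 : ∑ a : ι → ZMod q, ((Fintype.card (ι → ZMod q) : ℝ))⁻¹ *
        (((ZMod.toCircle (a ⬝ᵥ (s - s')) : Circle) : ℂ).re * X) =
        ((Fintype.card (ι → ZMod q) : ℝ))⁻¹ * X *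
          ∑ a : ι → ZMod q, ((ZMod.toCircle (a ⬝ᵥ (s - s')) : Circle) : ℂ).re := by
      rw [mul_sum]
      exact sum_congr rfl fun a _ => by ring
    have h3 : ∑ a : ι → ZMod q, ((Fintype.card (ι → ZMod q) : ℝ))⁻¹ *
        (((ZMod.toCircle (a ⬝ᵥ (s - s')) : Circle) : ℂ).im * Y) =
        ((Fintype.card (ι → ZMod q) : ℝ))⁻¹ * Y *
          ∑ a : ι → ZMod q, ((ZMod.toCircle (a ⬝ᵥ (s - s')) : Circle) : ℂ).im := by
      rw [mul_sum]
      exact sum_congr rfl fun a _ => by ring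
    rw [h2, h3, hre, him, mul_zero, mul_zero, sub_zero]

end Sample

/-! ### The `s' = s` mean for the discretised Gaussian: rounding costs at most `π/Q` -/

section GaussianMean

variable (Q : ℕ) [NeZero Q]

/-- The fine character on a rounded real: `Re e^{2πi⌊Qx⌉/Q} = cos(2π⌊Qx⌉/Q)`. [folklore] -/
theorem re_toCircle_discretize (x : ℝ) :
    ((ZMod.toCircle (LWE.discretize Q x) : Circle) : ℂ).re = Real.cos (2 * π * round ((Q : ℝ) * x) / Q) := by
  rw [LWE.discretize, ZMod.toCircle_intCast]
  have h : (2 * π * I * (round ((Q : ℝ) * x) : ℤ) / (Q : ℂ)) =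
      ((2 * π * round ((Q : ℝ) * x) / Q : ℝ) : ℂ) * I := by
    push_cast
    ring
  rw [h, Complex.exp_ofReal_mul_I_re]

/-- Rounding at scale `1/Q` moves `cos(2π·)` by at most `π/Q`: `cos(2π⌊Qx⌉/Q) ≥ cos(2πx) - π/Q`.
[folklore] -/
theorem cos_round_ge (x : ℝ) :
    Real.cos (2 * π * x) - π / Q ≤ Real.cos (2 * π * round ((Q : ℝ) * x) / Q) := by
  have hQ : (0 : ℝ) < Q := Nat.cast_pos.2 (Nat.pos_of_ne_zero (NeZero.ne Q))
  have h1 := Real.abs_cos_sub_cos_le (2 * π * x) (2 * π * round ((Q : ℝ) * x) / Q)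
  have h2 : |2 * π * x - 2 * π * round ((Q : ℝ) * x) / Q| ≤ π / Q := by
    rw [show 2 * π * x - 2 * π * round ((Q : ℝ) * x) / Q = (2 * π / Q) * ((Q : ℝ) * x - round ((Q : ℝ) * x)) by
      field_simp]
    rw [abs_mul, abs_of_pos (by positivity)]
    calc 2 * π / Q * |(Q : ℝ) * x - round ((Q : ℝ) * x)| ≤ 2 * π / Q * (1 / 2) :=
          mul_le_mul_of_nonneg_left (abs_sub_round _) (by positivity)
      _ = π / Q := by ring
  have h3 := (abs_sub_le_iff.1 (h1.trans h2)).1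
  linarith

/-- **`cosMean Ψ̄^{(Q)}_β ≥ e^{-πβ²} - π/Q`.** The discretised Gaussian `Ψ̄^{(Q)}_β` is the law of
`⌊QX⌉ mod Q`, `X ∼ N(0, β²/(2π))`; `E[cos 2πX] = e^{-πβ²}` (Regev: "a routine calculation shows that
for `ξ = Ψ_α`, `z̃ = e^{-πα²}`", `integral_cosTwoPi_wrappedGaussian`) and the rounding costs `≤ π/Q`
pointwise. [cite: RegevLWE2009, Lemma 3.6 (proof)] -/
theorem exp_sub_le_cosMean_discretizedGaussian (β : ℝ) :
    Real.exp (-(π * β ^ 2)) - π / Q ≤ cosMean (LWE.discretizedGaussian Q β) := by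
  set μ : Measure ℝ := gaussianReal 0 (Real.toNNReal (β ^ 2 / (2 * π))) with hμ
  set g : ZMod Q → ℝ := fun e => ((ZMod.toCircle e : Circle) : ℂ).re with hg
  have hmeas : Measurable (LWE.discretize Q) := LWE.measurable_discretize Q
  haveI : IsProbabilityMeasure (μ.map (LWE.discretize Q)) :=
    Measure.isProbabilityMeasure_map hmeas.aemeasurable
  -- `cosMean Ψ̄ = ∫ g d(μ.map discretize) = ∫ g ∘ discretize dμ`
  have h1 : cosMean (LWE.discretizedGaussian Q β) = ∫ e, g e ∂(μ.map (LWE.discretize Q)) := by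
    have hint : Integrable g (μ.map (LWE.discretize Q)) := .of_finite
    rw [integral_fintype hint, cosMean]
    refine sum_congr rfl fun e _ => ?_
    rw [LWE.discretizedGaussian, Measure.toPMF_apply, measureReal_def, smul_eq_mul]
  have h2 : ∫ e, g e ∂(μ.map (LWE.discretize Q)) = ∫ x, g (LWE.discretize Q x) ∂μ :=
    integral_map hmeas.aemeasurable (measurable_of_countable g).aestronglyMeasurable
  -- the torus mean
  have h3 : ∫ x, Real.cos (2 * π * x) ∂μ = Real.exp (-(π * β ^ 2)) := by
    have hcont : Continuous cosTwoPi := Complex.continuous_re.comp continuous_toCircle_coe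
    have h := integral_cosTwoPi_wrappedGaussian β
    rw [LWE.wrappedGaussian, integral_map LWE.measurable_coe_unitAddCircle.aemeasurable
      hcont.aestronglyMeasurable] at h
    simp_rw [cosTwoPi_coe] at h
    exact h
  rw [h1, h2, ← h3]
  have hc : Integrable (fun x : ℝ => Real.cos (2 * π * x)) μ :=
    Integrable.of_bound (Real.continuous_cos.comp (continuous_const.mul continuous_id)).aestronglyMeasurable
      1 (Filter.Eventually.of_forall fun x => by simpa using Real.abs_cos_le_one _)
  have hgi : Integrable (fun x : ℝ => g (LWE.discretize Q x)) μ :=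
    Integrable.of_bound ((measurable_of_countable g).comp hmeas).aestronglyMeasurable 1
      (Filter.Eventually.of_forall fun x => by
        simpa [hg] using (Complex.abs_re_le_norm _).trans_eq (Circle.norm_coe _))
  calc ∫ x, Real.cos (2 * π * x) ∂μ - π / Q = ∫ x, (Real.cos (2 * π * x) - π / Q) ∂μ := by
        rw [integral_sub hc (integrable_const _), integral_const, probReal_univ, one_smul]
    _ ≤ ∫ x, g (LWE.discretize Q x) ∂μ := by
        refine integral_mono (hc.sub (integrable_const _)) hgi fun x => ?_
        simp only [hg]
        rw [re_toCircle_discretize]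
        exact cos_round_ge Q x

end GaussianMean

/-! ### The test on a batch of `N` samples: Hoeffding -/

section Test

variable {ι : Type} [Fintype ι] [DecidableEq ι] (q K : ℕ) [NeZero q] [NeZero K]

/-- Regev's statistic summed over a batch of `N` fine samples (his `n·z`). [cite: RegevLWE2009, Lemma 3.6 (proof)] -/
def verifyStat {N : ℕ} (s' : ι → ZMod q) (y : Fin N → (ι → ZMod q) × ZMod (q * K)) : ℝ :=
  ∑ j, testCos q K s' (y j)

/-- The acceptance event of the test with threshold `θ` on the empirical mean: `∑ⱼ cos(2πyⱼ) ≥ Nθ`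
(Regev: "if `z > 0.02` we accept"). [cite: RegevLWE2009, Lemma 3.6 (proof)] -/
def acceptSet (N : ℕ) (θ : ℝ) (s' : ι → ZMod q) : Set (Fin N → (ι → ZMod q) × ZMod (q * K)) :=
  {y | (N : ℝ) * θ ≤ verifyStat q K s' y}

/-- **Wrong candidate: false acceptance is exponentially unlikely.** For `s' ≠ s`, `θ ≥ 0` and a batch
of `N` independent samples from `A^{(K)}_{s,χ}`: `Pr[accept] ≤ exp(-Nθ²/8)` (mean `0`, Hoeffding).
[cite: RegevLWE2009, Lemma 3.6 (proof)] -/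
theorem toReal_accept_of_ne_le (χ : PMF (ZMod (q * K))) {s s' : ι → ZMod q} (h : s' ≠ s) (N : ℕ)
    {θ : ℝ} (hθ : 0 ≤ θ) :
    ((LWE.iidPMF (lweSampleK q K χ s) N).toOuterMeasure (acceptSet q K N θ s')).toReal ≤
      Real.exp (-((N : ℝ) * θ ^ 2 / 8)) := by
  have hm := tsum_lweSampleK_testCos q K χ s s'
  rw [tsum_fintype, if_neg h] at hm
  have hmean : ∀ j : Fin N, ∑ x, ((fun _ => lweSampleK q K χ s) j x).toReal * testCos q K s' x ≤ 0 :=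
    fun j => hm.le
  have hmain := toReal_toOuterMeasure_indepLaw_sum_ge_mul_le (fun _ : Fin N => lweSampleK q K χ s)
    (testCos q K s') one_pos (abs_testCos_le_one q K s') hmean hθ
  rw [LWE.indepLaw_const] at hmain
  have hset : acceptSet q K N θ s' = {y | (N : ℝ) * θ ≤ ∑ j, testCos q K s' (y j)} := rfl
  rw [hset]
  refine hmain.trans (le_of_eq ?_)
  congr 1
  ring

/-- **Right candidate: false rejection is exponentially unlikely.** For a threshold `θ ≤ cosMean χ` and a
batch of `N` independent samples from `A^{(K)}_{s,χ}`: `Pr[reject s] ≤ exp(-N(cosMean χ - θ)²/8)`.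
[cite: RegevLWE2009, Lemma 3.6 (proof)] -/
theorem toReal_reject_self_le (χ : PMF (ZMod (q * K))) (s : ι → ZMod q) (N : ℕ) {θ : ℝ}
    (hθ : θ ≤ cosMean χ) :
    ((LWE.iidPMF (lweSampleK q K χ s) N).toOuterMeasure (acceptSet q K N θ s)ᶜ).toReal ≤
      Real.exp (-((N : ℝ) * (cosMean χ - θ) ^ 2 / 8)) := by
  have hm := tsum_lweSampleK_testCos q K χ s s
  rw [tsum_fintype, if_pos rfl] at hm
  have hmean : ∀ j : Fin N, cosMean χ ≤ ∑ x, ((fun _ => lweSampleK q K χ s) j x).toReal * testCos q K s x :=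
    fun j => hm.ge
  have hmain := toReal_toOuterMeasure_indepLaw_sum_lt_mul_le (fun _ : Fin N => lweSampleK q K χ s)
    (testCos q K s) one_pos (abs_testCos_le_one q K s) hmean hθ
  rw [LWE.indepLaw_const] at hmain
  have hset : (acceptSet q K N θ s)ᶜ = {y | ∑ j, testCos q K s (y j) < (N : ℝ) * θ} := by
    ext y
    simp only [acceptSet, verifyStat, Set.mem_compl_iff, Set.mem_setOf_eq, not_le]
  rw [hset]
  refine hmain.trans (le_of_eq ?_)
  congr 1
  ring

/-! ### The instance used by the reduction: `χ = Ψ̄^{(qK)}_β`, `|β| ≤ α`, threshold `e^{-πα²}/2` -/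

/-- The threshold of the test for noise rates up to `α`: `θ_α = e^{-πα²}/2`. [cite: RegevLWE2009, Lemma 3.6 (proof: threshold `0.02`)] -/
def threshold (α : ℝ) : ℝ := Real.exp (-(π * α ^ 2)) / 2

/-- `θ_α > 0`. [folklore] -/
theorem threshold_pos (α : ℝ) : 0 < threshold α := by unfold threshold; positivity

/-- The gap on the `s' = s` side: for `|β| ≤ α` and `4π e^{πα²} ≤ qK` (so `π/(qK) ≤ e^{-πα²}/4`),
`cosMean Ψ̄^{(qK)}_β - θ_α ≥ e^{-πα²}/4`. [cite: RegevLWE2009, Lemma 3.6 (proof)] -/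
theorem gap_le_cosMean_sub_threshold {α β : ℝ} (hβ : |β| ≤ α) {Q : ℕ} [NeZero Q]
    (hQ : 4 * π * Real.exp (π * α ^ 2) ≤ Q) :
    Real.exp (-(π * α ^ 2)) / 4 ≤ cosMean (LWE.discretizedGaussian Q β) - threshold α := by
  have hQpos : (0 : ℝ) < Q := lt_of_lt_of_le (by positivity) hQ
  have h1 := exp_sub_le_cosMean_discretizedGaussian Q β
  have h2 : Real.exp (-(π * α ^ 2)) ≤ Real.exp (-(π * β ^ 2)) := by
    have : β ^ 2 ≤ α ^ 2 := by
      have h := sq_le_sq' (abs_le.1 hβ).1 (abs_le.1 hβ).2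
      simpa using h
    exact Real.exp_le_exp.2 (by nlinarith [Real.pi_pos])
  have h3 : π / Q ≤ Real.exp (-(π * α ^ 2)) / 4 := by
    rw [div_le_div_iff₀ hQpos (by norm_num : (0:ℝ) < 4), Real.exp_neg]
    have hE : 0 < Real.exp (π * α ^ 2) := Real.exp_pos _
    field_simp
    nlinarith [hQ, hE]
  unfold threshold
  linarith

/-- **Lemma 3.6, wrong candidate, concrete form**: `N` samples from `A^{(K)}_{s,Ψ̄_β}`, threshold `θ_α`:
`Pr[accept s' ≠ s] ≤ exp(-N e^{-2πα²}/32)`. [cite: RegevLWE2009, Lemma 3.6] -/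
theorem toReal_accept_of_ne_le_exp (α β : ℝ) {s s' : ι → ZMod q} (h : s' ≠ s) (N : ℕ) :
    ((LWE.iidPMF (lweSampleK q K (LWE.discretizedGaussian (q * K) β) s) N).toOuterMeasure
        (acceptSet q K N (threshold α) s')).toReal ≤
      Real.exp (-((N : ℝ) * Real.exp (-(2 * π * α ^ 2)) / 32)) := by
  refine (toReal_accept_of_ne_le q K _ h N (threshold_pos α).le).trans (le_of_eq ?_)
  congr 1
  unfold threshold
  rw [div_pow, ← Real.exp_nat_mul]
  push_cast
  ring_nf

/-- **Lemma 3.6, right candidate, concrete form**: `N` samples from `A^{(K)}_{s,Ψ̄_β}` with `|β| ≤ α`,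
`4π e^{πα²} ≤ qK`, threshold `θ_α`: `Pr[reject s] ≤ exp(-N e^{-2πα²}/128)`. [cite: RegevLWE2009, Lemma 3.6] -/
theorem toReal_reject_self_le_exp {α β : ℝ} (hβ : |β| ≤ α) (hQ : 4 * π * Real.exp (π * α ^ 2) ≤ (q * K : ℕ))
    (s : ι → ZMod q) (N : ℕ) :
    ((LWE.iidPMF (lweSampleK q K (LWE.discretizedGaussian (q * K) β) s) N).toOuterMeasure
        (acceptSet q K N (threshold α) s)ᶜ).toReal ≤
      Real.exp (-((N : ℝ) * Real.exp (-(2 * π * α ^ 2)) / 128)) := by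
  have hgap := gap_le_cosMean_sub_threshold hβ hQ
  have hθ : threshold α ≤ cosMean (LWE.discretizedGaussian (q * K) β) := by
    have : 0 < Real.exp (-(π * α ^ 2)) / 4 := by positivity
    linarith
  refine (toReal_reject_self_le q K _ s N hθ).trans ?_
  rw [Real.exp_le_exp, neg_le_neg_iff]
  have hg0 : 0 ≤ Real.exp (-(π * α ^ 2)) / 4 := by positivity
  have hsq : (Real.exp (-(π * α ^ 2)) / 4) ^ 2 ≤
      (cosMean (LWE.discretizedGaussian (q * K) β) - threshold α) ^ 2 := pow_le_pow_left₀ hg0 hgap 2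
  have hN : (0 : ℝ) ≤ N := Nat.cast_nonneg _
  have hexp : Real.exp (-(2 * π * α ^ 2)) = Real.exp (-(π * α ^ 2)) ^ 2 := by
    rw [← Real.exp_nat_mul]; push_cast; ring_nf
  rw [hexp]
  calc (N : ℝ) * Real.exp (-(π * α ^ 2)) ^ 2 / 128 = (N : ℝ) * (Real.exp (-(π * α ^ 2)) / 4) ^ 2 / 8 := by ring
    _ ≤ (N : ℝ) * (cosMean (LWE.discretizedGaussian (q * K) β) - threshold α) ^ 2 / 8 := by
        gcongr

end Test

end Regev2009

end Literature.Computability.Cryptography
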